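import Literature.Geometry.Riemannian.PerelmanEntropy
import HarnessLib

/-!
# Gradient shrinking Ricci solitons: the soliton equation, the normalised potential and the
# Gaussian density (Cao–Hamilton–Ilmanen; Carrillo–Ni)

Definitions (real, with bodies) over the metric vocabulary of
`Literature/Geometry/{Lorentzian,Riemannian}` (`PseudoRiemannianMetric` with its standing
Levi-Civita hypothesis `[g.HasLeviCivita]`, `g.ricci`, `g.hessian`, `g.scalarCurvature`, the
gradient square `g.gradSq f = |∇f|²_g` and the Riemannian measure `g.riemVolume`), next to
`PerelmanEntropy.lean` (whose `entropyDensity`, `𝒲`, `μ` they complement):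

* `g.IsGradientShrinker f τ` — the **gradient shrinking soliton equation**
  `Ric_g + Hess_g f = g / (2τ)` pointwise (Carrillo–Ni 2009, (1.2):
  `R_{ij} + f_{ij} - g_{ij}/(2τ) = 0`; Cao–Hamilton–Ilmanen 2004, §1 with `τ = 1`), for a metric
  `g` (meant: Riemannian, smooth), a potential `f : M → ℝ` (meant: smooth) and a scale `τ` (meant:
  `> 0`) — the predicate is the bare tensor identity, smoothness and positivity being stated
  separately where needed (as in the route items it serves);
* `g.IsNormalisedShrinker f τ` — the soliton equation together with the **normalisation of the
  potential** `R + |∇f|² = f/τ`. On a connected gradient shrinker `R + |∇f|² - f/τ` is constant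
  (Hamilton's identity; Carrillo–Ni 2009, (2.2): `S + |∇f|² - f/τ = μ_s(τ)/τ`), so the
  normalisation fixes the free additive constant of `f`;
* `g.shrinkerDensity f τ = Θ = (4πτ)^{-n/2} ∫_M e^{-f} dV ∈ [0, ∞]` — the **Gaussian density**
  (Cao–Hamilton–Ilmanen 2004, §3, "central density" of a shrinker), an extended nonnegative real
  (`lintegral`; `n = dim M = finrank ℝ E`);
* the named fact `carrilloNi_muEntropy_eq_log_shrinkerDensity` — on a CLOSED connected
  normalised gradient shrinker `μ(g, 1) = log Θ` (Carrillo–Ni 2009, Cor. 4.1, in the tree's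
  normalisation; see its docstring for the dictionary), i.e. `Θ = e^{μ(g,1)}`.

Proved API: the `τ = 1` forms literally used by route `SmoothPoincare4/EntropyRung`
(`isGradientShrinker_one_iff`, `isNormalisedShrinker_one_iff`); Einstein metrics with locally
constant potential are shrinkers (`IsGradientShrinker.of_ricci_eq_smul`); the density as the
`lintegral` of Perelman's density `u` (`shrinkerDensity_eq_lintegral_entropyDensity`), its value
for a constant potential (`shrinkerDensity_const`), and compatibility `∫ u dV = 1` iff `Θ = 1`
for (a.e. strongly) measurable `f` (`isEntropyCompatible_iff_shrinkerDensity_eq_one`).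

Sanity values (Cao–Hamilton–Ilmanen 2004, §3, Table; not formalised — they need the volumes of
round spheres and the Gaussian integral): `Θ(ℝ⁴) = 1`, `Θ(S⁴) = 6/e² ≈ 0.812`,
`Θ(S³ × ℝ) = 2√π e^{-3/2} ≈ 0.791`, `Θ(S² × ℝ²) = 2/e ≈ 0.736` (all at `τ = 1`, normalised
potential; e.g. for `S⁴` of radius `√6`: `Ric = g/2`, `f ≡ R = 2`, `Vol = (8π²/3)·36`,
`Θ = 96π² e^{-2}/(16π²) = 6/e²`).

What is NOT here: Hamilton's identity itself (constancy of `R + |∇f|² - f/τ`), the Gaussian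
decay/integrability of `e^{-f}` on complete noncompact shrinkers (Carrillo–Ni 2009, Thm. 1.1 (i);
Cao–Zhou 2009), Yokota's gap theorem `Θ ≤ 1`, and the noncompact case of `Θ = e^{μ}` (there the
tree's Bochner-integral `𝒲`/`μ` of `PerelmanEntropy.lean` range over all smooth compatible test
functions with junk value `0` for non-integrable integrands, which is not the admissible class of
Carrillo–Ni's Thm. 1.1 (ii) — compactly supported, or bounded second moment — so the printed
theorem does not literally cover it; only the closed case is vendored).

## References

* J. A. Carrillo, L. Ni, *Sharp logarithmic Sobolev inequalities on gradient solitons and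
  applications*, Comm. Anal. Geom. 17 (2009), 721–753 (arXiv:0806.2417): (1.1)–(1.4), (2.1)–(2.3),
  Cor. 4.1, Rem. 4.2. READ (arXiv version pp. 3, 5, 9). [CarrilloNi2009]
* H.-D. Cao, R. S. Hamilton, T. Ilmanen, *Gaussian densities and stability for some Ricci
  solitons*, arXiv:math/0404165 (2004), §§1, 3. [CaoHamiltonIlmanen2004]
* Y. Li, B. Wang, *Heat kernel on Ricci shrinkers*, (2019), (2.5). [LiWang2019]
* G. Perelman, arXiv:math/0211159 (2002), §3.1. [Perelman2002]
-/

noncomputable section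

open Bundle Set Module Filter MeasureTheory Manifold
open scoped ContDiff Topology ENNReal NNReal

namespace Literature.Geometry.Riemannian

open Lorentzian

variable {E : Type*} [NormedAddCommGroup E] [NormedSpace ℝ E] [FiniteDimensional ℝ E]
  {H : Type*} [TopologicalSpace H] {I : ModelWithCorners ℝ E H} {M : Type*} [TopologicalSpace M]
  [ChartedSpace H M] [IsManifold I ∞ M]

/-! ### The soliton equation and the normalised potential -/

section Soliton

/-- **Gradient shrinking Ricci soliton** structure `(g, f, τ)`: the pointwise tensor identity
`Ric_g(X, Y) + Hess_g f (X, Y) = g(X, Y) / (2τ)` on every tangent space (Carrillo–Ni 2009, (1.2);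
Cao–Hamilton–Ilmanen 2004, §1 for `τ = 1`). Meant for `g` Riemannian with its Levi-Civita
connection (standing hypothesis `[g.HasLeviCivita]`), `f` smooth and `τ > 0`; for `τ = 0` the
right-hand side is Lean's `1 / 0 = 0` (junk: "steady" equation), never used.
[cite: CarrilloNi2009, (1.2)] -/
def _root_.Literature.Geometry.Lorentzian.PseudoRiemannianMetric.IsGradientShrinker
    (g : PseudoRiemannianMetric I ∞ E (TangentSpace I : M → Type _)) [g.HasLeviCivita]
    (f : M → ℝ) (τ : ℝ) : Prop :=
  ∀ (x : M) (X Y : TangentSpace I x),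
    g.ricci x X Y + g.hessian f x X Y = 1 / (2 * τ) * g.val x X Y

/-- **Normalised gradient shrinker**: the soliton equation `Ric + Hess f = g/(2τ)` together with
the normalisation `R + |∇f|² = f/τ` of the potential (Carrillo–Ni 2009, (2.2) with the constant
`μ_s(τ) = 0`; on a connected shrinker `R + |∇f|² - f/τ` is constant, so this only fixes the
additive constant of `f`). [cite: CarrilloNi2009, (2.2)] -/
def _root_.Literature.Geometry.Lorentzian.PseudoRiemannianMetric.IsNormalisedShrinker
    (g : PseudoRiemannianMetric I ∞ E (TangentSpace I : M → Type _)) [g.HasLeviCivita]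
    (f : M → ℝ) (τ : ℝ) : Prop :=
  g.IsGradientShrinker f τ ∧ ∀ x : M, g.scalarCurvature x + g.gradSq f x = f x / τ

variable (g : PseudoRiemannianMetric I ∞ E (TangentSpace I : M → Type _)) [g.HasLeviCivita]

omit [FiniteDimensional ℝ E] in
/-- Unfolding of the soliton equation. [cite: CarrilloNi2009, (1.2)] -/
theorem _root_.Literature.Geometry.Lorentzian.PseudoRiemannianMetric.isGradientShrinker_iff
    (f : M → ℝ) (τ : ℝ) :
    g.IsGradientShrinker f τ ↔ ∀ (x : M) (X Y : TangentSpace I x),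
      g.ricci x X Y + g.hessian f x X Y = 1 / (2 * τ) * g.val x X Y :=
  Iff.rfl

omit [FiniteDimensional ℝ E] in
/-- The soliton equation at scale `τ = 1`, in the form `Ric + Hess f = (1/2) g` used by route
`SmoothPoincare4/EntropyRung`. [cite: CaoHamiltonIlmanen2004, §1] -/
theorem _root_.Literature.Geometry.Lorentzian.PseudoRiemannianMetric.isGradientShrinker_one_iff
    (f : M → ℝ) :
    g.IsGradientShrinker f 1 ↔ ∀ (x : M) (X Y : TangentSpace I x),
      g.ricci x X Y + g.hessian f x X Y = (1 / 2 : ℝ) * g.val x X Y := by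
  simp only [PseudoRiemannianMetric.IsGradientShrinker, mul_one]

/-- Unfolding of the normalised soliton structure. [cite: CarrilloNi2009, (2.2)] -/
theorem _root_.Literature.Geometry.Lorentzian.PseudoRiemannianMetric.isNormalisedShrinker_iff
    (f : M → ℝ) (τ : ℝ) :
    g.IsNormalisedShrinker f τ ↔
      g.IsGradientShrinker f τ ∧ ∀ x : M, g.scalarCurvature x + g.gradSq f x = f x / τ :=
  Iff.rfl

/-- The normalised soliton structure at scale `τ = 1`: `Ric + Hess f = g/2` and
`R + |∇f|² = f`, the two clauses used by route `SmoothPoincare4/EntropyRung`.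
[cite: CarrilloNi2009, (1.1) and (2.2)] -/
theorem _root_.Literature.Geometry.Lorentzian.PseudoRiemannianMetric.isNormalisedShrinker_one_iff
    (f : M → ℝ) :
    g.IsNormalisedShrinker f 1 ↔
      (∀ (x : M) (X Y : TangentSpace I x),
          g.ricci x X Y + g.hessian f x X Y = (1 / 2 : ℝ) * g.val x X Y) ∧
        ∀ x : M, g.scalarCurvature x + g.gradSq f x = f x := by
  simp only [PseudoRiemannianMetric.IsNormalisedShrinker,
    PseudoRiemannianMetric.isGradientShrinker_one_iff, div_one]

variable {g} in
/-- A normalised shrinker is a shrinker. [folklore] -/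
theorem _root_.Literature.Geometry.Lorentzian.PseudoRiemannianMetric.IsNormalisedShrinker.isGradientShrinker
    {f : M → ℝ} {τ : ℝ} (h : g.IsNormalisedShrinker f τ) : g.IsGradientShrinker f τ :=
  h.1

variable {g} in
/-- The normalisation `R + |∇f|² = f/τ` of a normalised shrinker. [cite: CarrilloNi2009, (2.2)] -/
theorem _root_.Literature.Geometry.Lorentzian.PseudoRiemannianMetric.IsNormalisedShrinker.scalarCurvature_add_gradSq
    {f : M → ℝ} {τ : ℝ} (h : g.IsNormalisedShrinker f τ) (x : M) :
    g.scalarCurvature x + g.gradSq f x = f x / τ :=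
  h.2 x

omit [FiniteDimensional ℝ E] in
variable {g} in
/-- **Einstein metrics are gradient shrinkers with constant potential**: if `Ric = λ g` and the
Hessian of `f` vanishes identically (e.g. `f` constant, `hessian_const`), then `(g, f, 1/(2λ))`
satisfies the soliton equation (Carrillo–Ni 2009, Rem. 4.2: "when `f` = constant, `(M, g)` is a
Einstein manifold with `Ric_M = ½ g_M`"; here for general `λ ≠ 0`). [cite: CarrilloNi2009, Rem. 4.2] -/
theorem _root_.Literature.Geometry.Lorentzian.PseudoRiemannianMetric.IsGradientShrinker.of_ricci_eq_smul
    {lam : ℝ} (hlam : lam ≠ 0) {f : M → ℝ}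
    (hRic : ∀ (x : M) (X Y : TangentSpace I x), g.ricci x X Y = lam * g.val x X Y)
    (hf : ∀ x : M, g.hessian f x = 0) : g.IsGradientShrinker f (1 / (2 * lam)) := by
  intro x X Y
  rw [hRic x X Y, hf x]
  simp only [LinearMap.zero_apply, add_zero]
  congr 1
  field_simp

end Soliton

/-! ### The Gaussian density -/

section Density

variable [T3Space M] [MeasurableSpace M] [BorelSpace M]

/-- **Gaussian density of a gradient shrinker** (Cao–Hamilton–Ilmanen's central density `Θ`):
`Θ(g, f, τ) = (4πτ)^{-n/2} ∫_M e^{-f} dV_g ∈ [0, ∞]`, `n = dim M`, as an extended nonnegative real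
(so that non-integrable potentials get `Θ = ∞`, not a junk `0`); `dV_g = g.riemVolume` (junk `0`
for non-Riemannian `g`). For a complete normalised shrinker this is `e^{μ(g, τ)}` (Carrillo–Ni
2009, Cor. 4.1; the closed case is `carrilloNi_muEntropy_eq_log_shrinkerDensity`).
[cite: CaoHamiltonIlmanen2004, §3] -/
def _root_.Literature.Geometry.Lorentzian.PseudoRiemannianMetric.shrinkerDensity
    (g : PseudoRiemannianMetric I ∞ E (TangentSpace I : M → Type _)) (f : M → ℝ) (τ : ℝ) : ℝ≥0∞ :=
  ENNReal.ofReal ((4 * Real.pi * τ) ^ (-(finrank ℝ E : ℝ) / 2)) *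
    ∫⁻ x, ENNReal.ofReal (Real.exp (-f x)) ∂g.riemVolume

variable (g : PseudoRiemannianMetric I ∞ E (TangentSpace I : M → Type _))

/-- Unfolding of the density. [cite: CaoHamiltonIlmanen2004, §3] -/
theorem _root_.Literature.Geometry.Lorentzian.PseudoRiemannianMetric.shrinkerDensity_def
    (f : M → ℝ) (τ : ℝ) :
    g.shrinkerDensity f τ =
      ENNReal.ofReal ((4 * Real.pi * τ) ^ (-(finrank ℝ E : ℝ) / 2)) *
        ∫⁻ x, ENNReal.ofReal (Real.exp (-f x)) ∂g.riemVolume :=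
  rfl

/-- The density is the `lintegral` of Perelman's density `u = (4πτ)^{-n/2} e^{-f}` of
`PerelmanEntropy.lean` (for `τ > 0`). [cite: Perelman2002, §3.1, (3.2)] -/
theorem _root_.Literature.Geometry.Lorentzian.PseudoRiemannianMetric.shrinkerDensity_eq_lintegral_entropyDensity
    (f : M → ℝ) {τ : ℝ} (hτ : 0 < τ) :
    g.shrinkerDensity f τ =
      ∫⁻ x, ENNReal.ofReal (entropyDensity (finrank ℝ E) f τ x) ∂g.riemVolume := by
  rw [PseudoRiemannianMetric.shrinkerDensity, ← lintegral_const_mul' _ _ ENNReal.ofReal_ne_top]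
  refine lintegral_congr fun x => ?_
  rw [entropyDensity_apply, ENNReal.ofReal_mul (entropyNormalisation_pos _ hτ).le]

/-- The density of a constant potential `f ≡ c`: `(4πτ)^{-n/2} e^{-c} Vol(M)`.
[cite: CarrilloNi2009, Rem. 4.2] -/
theorem _root_.Literature.Geometry.Lorentzian.PseudoRiemannianMetric.shrinkerDensity_const
    (c τ : ℝ) :
    g.shrinkerDensity (fun _ : M ↦ c) τ =
      ENNReal.ofReal ((4 * Real.pi * τ) ^ (-(finrank ℝ E : ℝ) / 2)) *
        (ENNReal.ofReal (Real.exp (-c)) * g.riemVolume univ) := by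
  rw [PseudoRiemannianMetric.shrinkerDensity, lintegral_const]

/-- **Compatibility is unit density**: for an a.e. strongly measurable potential and `τ > 0`,
Perelman's compatibility `∫ u dV = 1` (`IsEntropyCompatible`, a Bochner integral) holds iff
`Θ = 1`. [cite: Perelman2002, §3.1, (3.2)] -/
theorem _root_.Literature.Geometry.Lorentzian.PseudoRiemannianMetric.isEntropyCompatible_iff_shrinkerDensity_eq_one
    {f : M → ℝ} (hf : AEStronglyMeasurable f g.riemVolume) {τ : ℝ} (hτ : 0 < τ) :
    g.IsEntropyCompatible f τ ↔ g.shrinkerDensity f τ = 1 := by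
  have hmeas : AEStronglyMeasurable (entropyDensity (finrank ℝ E) f τ) g.riemVolume := by
    unfold entropyDensity
    exact aestronglyMeasurable_const.mul (Real.continuous_exp.comp_aestronglyMeasurable hf.neg)
  have hnn : 0 ≤ᵐ[g.riemVolume] entropyDensity (finrank ℝ E) f τ :=
    Eventually.of_forall fun x => (entropyDensity_pos _ f hτ x).le
  rw [PseudoRiemannianMetric.isEntropyCompatible_iff,
    g.shrinkerDensity_eq_lintegral_entropyDensity f hτ, integral_eq_lintegral_of_nonneg_ae hnn hmeas,
    ENNReal.toReal_eq_one_iff]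

end Density

/-! ### The density of a closed normalised shrinker is `e^{μ(g, 1)}` (named fact) -/

universe u

/-- NAMED FACT (**Carrillo–Ni 2009, Cor. 4.1**, closed case, in the tree's normalisation). Let
`(M, g)` be a closed (compact, boundaryless) connected Riemannian manifold, `f` smooth, with
`Ric + Hess f = g/2` and `R + |∇f|² = f` (`g.IsNormalisedShrinker f 1`). Then Perelman's
`μ(g, 1)` (`PseudoRiemannianMetric.muEntropy` of `PerelmanEntropy.lean`, for the Levi-Civita
connection) equals `log Θ`, `Θ = (4π)^{-n/2} ∫_M e^{-f} dV` (`g.shrinkerDensity f 1`); i.e.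
`Θ = e^{μ(g,1)}`. Dictionary with the source: Carrillo–Ni normalise the potential by
`(4π)^{-n/2} ∫ e^{-f̃} dV = 1` ((1.4)) and define the soliton constant `μ_s` by
`S + |∇f̃|² - f̃ = μ_s` ((2.2), `τ = 1`); Cor. 4.1 states `μ(g, 1) = -μ_s`, the potential
`u = (4π)^{-n/2} e^{-f̃}` being the minimiser of `𝒲(g, ·, 1)` (displayed identity before Cor. 4.1,
after Perelman). With `f` normalised as here, `f̃ = f + log Θ` satisfies (1.4) and
`S + |∇f̃|² - f̃ = -log Θ`, so `μ_s = -log Θ` and `μ(g, 1) = log Θ`. Connectedness is needed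
(on `M₁ ⊔ M₂`, `μ ≤ min(log Θ₁, log Θ₂) < log(Θ₁ + Θ₂)`); compactness makes every smooth `ψ`
admissible in both senses (Carrillo–Ni's Thm. 1.1 (ii) is stated for compactly supported
densities) — the complete noncompact case is NOT asserted here (module docstring). Also recorded
as Li–Wang 2019, (2.5). Users take `(h : carrilloNi_muEntropy_eq_log_shrinkerDensity)`.
[cite: CarrilloNi2009, Cor. 4.1] -/
def carrilloNi_muEntropy_eq_log_shrinkerDensity : Prop :=
  ∀ (E : Type u) [NormedAddCommGroup E] [NormedSpace ℝ E] [FiniteDimensional ℝ E]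
    (H : Type u) [TopologicalSpace H] (I : ModelWithCorners ℝ E H) [I.Boundaryless]
    (M : Type u) [TopologicalSpace M] [ChartedSpace H M] [IsManifold I ∞ M] [T3Space M]
    [MeasurableSpace M] [BorelSpace M] [CompactSpace M] [ConnectedSpace M]
    (g : PseudoRiemannianMetric I ∞ E (TangentSpace I : M → Type _)) [g.HasLeviCivita] (f : M → ℝ),
    g.IsRiemannian → ContMDiff I 𝓘(ℝ, ℝ) ∞ f → g.IsNormalisedShrinker f 1 →
      g.muEntropy g.leviCivita 1 = ((Real.log (g.shrinkerDensity f 1).toReal : ℝ) : EReal)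

end Literature.Geometry.Riemannian
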